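import Literature.Probability.LatticeModels.GridDomainHittingProbabilityProofs
import Literature.Probability.LatticeModels.LatticeHarmonicCompactness
import Literature.Probability.LatticeModels.DiscreteHarmonicLimit
import Literature.Analysis.Complex.UnivalentSequenceLimits
import HarnessLib

/-!
# Nonnegative lattice-harmonic functions on grid domains in conformal coordinates: uniform bounds,
# asymptotic equicontinuity, subsequential continuous limits (towards LSW 2004, Lemma 5.3)

Topic `Literature/Probability/LatticeModels` (discrete potential theory on `ℤ²` → continuum;
continuation of `GridDomainHittingProbabilityProofs.lean`, `LatticeHarnackConformal.lean`,
`ScalingLimitCompactness.lean`). G. F. Lawler, O. Schramm, W. Werner, *Conformal invariance of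
planar loop-erased random walks and uniform spanning trees*, Ann. Probab. 32 (2004), Lemma 5.3
("Continuous harmonic approximation", arXiv math/0112234 Lemma 32) is proved by compactness: "Our
objective is to apply compactness to show that the maps `h_n ∘ ψ_{D_n}⁻¹` converge locally uniformly
in `𝕌` as `n → ∞` along some subsequence to some harmonic `ĥ` … If `K ⊂ 𝕌` is compact, then
Lemma 5.2 shows that there is a constant `C > 0` such that for all sufficiently large `n` in the
subsequence, the discrete derivatives `|∂_x^δ h^n|` and `|∂_y^δ h^n|` are bounded by `C` in
`φ(K) ∩ δ V_{D_n}`. By a variant of the Arzelà–Ascoli Theorem, it then follows that there is some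
continuous `h*` … and a further subsequence such that [uniform convergence on compacta]". This file
carries out the equicontinuity-and-extraction half of that argument, directly in the conformal
coordinate `ζ ∈ 𝔻` (the sampled function `ζ ↦ h(nearestSite 1 (ψ⁻¹ ζ))`), for the class `𝔇` and
the disc maps of `GridDomainHittingProbability.lean`:

* `LSWGrid.sample_le` — **uniform bound**: `h(nearestSite(ψ⁻¹ ζ)) ≤ (2/c_*)^N h(0)` for `|ζ| ≤ r`
  (`harnack_conformal`);
* `LSWGrid.exists_coord_of_norm_sub_lt`, `LSWGrid.abs_step_le_of_norm_sub_lt`,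
  `LSWGrid.norm_inv_sub_inv_le`, `LSWGrid.abs_sample_sub_sample_le` — points Euclidean-close to
  `ψ⁻¹ ζ` have conformal radius `≤ (1+r)/2` (Koebe), hence a uniform per-step gradient bound there
  (`lipschitz_conformal`); conformal displacements control Euclidean ones (Koebe); the `ℓ¹`
  staircase (`abs_sub_le_of_gradient`) then bounds the variation between two sampled sites;
* `LSWGrid.exists_equicontinuity_const` — **asymptotic equicontinuity, uniformly over `𝔇`**: for
  `0 ≤ r < 1` there is `L = L(r)` with
  `|h(site ψ⁻¹ζ) - h(site ψ⁻¹ζ')| ≤ L h(0) (|ζ - ζ'| + 1/inrad(D))` for `|ζ|, |ζ'| ≤ r`, whenever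
  `inrad(D) (1-r)² ≥ 1.6·10⁵`;
* `LSWGrid.exists_subseq_tendstoUniformlyOn_sample` — **extraction**: for a sequence
  `(D_n, ψ_n, h_n)` with `h_n(0) = 1` and `inrad(D_n) → ∞`, along a subsequence the sampled
  functions converge uniformly on every compact subset of `𝔻` to a function continuous on `𝔻`
  (`exists_subseq_tendstoUniformlyOn_of_asympEquicontinuous`).

* `LSWGrid.harmonicOnNhd_of_sample_limit` — **the limit is harmonic on `𝔻`**: Montel for the
  rescaled maps `ψ_n⁻¹/inrad(D_n)` (`exists_subseq_tendstoLocallyUniformlyOn_univalent`), kernel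
  inclusion (`eventually_image_subset_image_ball`) to see that mesh points of a small Euclidean
  disc of the limit picture are lattice points of `D_n`, `harmonicOnNhd_of_latticeHarmonic_limit`
  there for `H = g ∘ Φ⁻¹`, and `g = H ∘ Φ` (`harmonicOnNhd_comp_of_differentiableOn`).

* `LSWGrid.continuousHarmonicApproximation_normalised`, **`LSWGrid.continuousHarmonicApproximation`**
  — **Lawler–Schramm–Werner's Lemma 5.3 itself**, as printed: for every `ε > 0` there is `r₀`
  such that for `D ∈ 𝔇` with `inrad(D) ≥ r₀`, every disc map `ψ` and every `h ≥ 0`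
  lattice-harmonic on `V(D)` there is a harmonic `h* ≥ 0` on `D` with `|h*(v) - h(v)| ≤ ε h(0)`
  at every `v ∈ V(D)` with `|ψ(v)| < 1 - ε` (contradiction + the three steps above; the case
  `h(0) = 0` by Harnack, the general case by normalising).

Everything here is proved; no named facts.

## References

* G. F. Lawler, O. Schramm, W. Werner, Ann. Probab. 32 (2004), Lemma 5.2, Lemma 5.3 and its proof
  (arXiv pp. 27–28). [LawlerSchrammWerner2004]
-/

noncomputable section

open Set Metric Filter
open scoped Topology

namespace Literature.Probability.LatticeModels

namespace LSWGrid

open Literature.Analysis.Complex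

/-! ### One domain: bounds in conformal coordinates -/

section OneDomain

variable {D : Set ℂ} (hD : IsClassD D) {ψ : ℂ → ℂ} (hψ : IsDiscMap D ψ)
include hD hψ

/-- The hypotheses of the tree's conformal toolkit for `F = ψ⁻¹`: the inner-radius ball, an
obstruction at distance `inrad(D)`, and "mesh points in `F(𝔻)` are lattice points of `D`".
[folklore] -/
theorem toolkit_hyps :
    ball (Function.invFunOn ψ D 0) (infDist (0 : ℂ) Dᶜ) ⊆ Function.invFunOn ψ D '' ball 0 1 ∧
    (∃ b : ℂ, b ∉ Function.invFunOn ψ D '' ball 0 1 ∧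
      ‖b - Function.invFunOn ψ D 0‖ ≤ infDist (0 : ℂ) Dᶜ) ∧
    (∀ y : Site 2, meshPoint 1 y ∈ Function.invFunOn ψ D '' ball 0 1 → y ∈ latticeVertices D) := by
  have hF0 : Function.invFunOn ψ D 0 = 0 := hψ.inv_zero hD.2.2.1
  have himg : Function.invFunOn ψ D '' ball 0 1 = D := hψ.image_inv
  obtain ⟨b, hbD, hbn⟩ := exists_notMem_norm_eq_inrad hD
  refine ⟨?_, ⟨b, by rwa [himg], ?_⟩, fun y hy => by rwa [himg, meshPoint_one] at hy⟩
  · rw [hF0, himg]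
    exact Metric.ball_infDist_compl_subset
  · rw [hF0, sub_zero, hbn]

/-- **Uniform bound on the sampled function** (Lemma 5.2, `k = 0`): for `h ≥ 0` lattice-harmonic
on `V(D)`, `r < 1` with `inrad(D)(1-r)² ≥ 10⁴` and `N ≥ 11000/(1-r)⁵`,
`h(nearestSite 1 (ψ⁻¹ ζ)) ≤ (2/c_*)^N h(0)` for all `|ζ| ≤ r`. [cite: LawlerSchrammWerner2004, Lemma 5.2] -/
theorem sample_le {h : Site 2 → ℝ} (hpos : ∀ w, 0 ≤ h w)
    (hh : IsLatticeHarmonicOn h (latticeVertices D)) {r : ℝ} (hr : r < 1)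
    (hbig : 10000 ≤ infDist (0 : ℂ) Dᶜ * (1 - r) ^ 2) {N : ℕ} (hN : 11000 / (1 - r) ^ 5 ≤ N)
    {ζ : ℂ} (hζ : ‖ζ‖ ≤ r) :
    h (nearestSite 1 (Function.invFunOn ψ D ζ)) ≤ (2 / maneuverConst) ^ N * h 0 := by
  obtain ⟨hsub, ⟨b, hb, hbρ⟩, hU⟩ := toolkit_hyps hD hψ
  have hρ₀ := inrad_pos hD
  have hbρ' : ‖b - Function.invFunOn ψ D 0‖ ≤ 2 * infDist (0 : ℂ) Dᶜ := by linarith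
  have key := (harnack_conformal (hψ.differentiableOn_inv hD.1.1) hψ.injOn_inv hρ₀ hsub hb hbρ'
    hpos hh hU hr hbig hN hζ).2
  rw [hψ.inv_zero hD.2.2.1, nearestSite_one_zero] at key
  have hc := maneuverConst_pos
  have hcN : 0 < (maneuverConst / 2) ^ N := by positivity
  rw [show (2 / maneuverConst) ^ N = ((maneuverConst / 2) ^ N)⁻¹ by
    rw [← inv_pow, inv_div]]
  rw [le_inv_mul_iff₀ hcN]
  exact key

/-- **Points Euclidean-close to `ψ⁻¹ ζ` are conformally interior** (Koebe): for `|ζ| ≤ r < 1`,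
every `v` with `|v - ψ⁻¹ ζ| < inrad(D)(1-r)²/64` is `ψ⁻¹ ζ'` with `|ζ'| ≤ (1+r)/2`.
[cite: LawlerSchrammWerner2004, §5.1] -/
theorem exists_coord_of_norm_sub_lt {r : ℝ} (hr : r < 1) {ζ : ℂ} (hζ : ‖ζ‖ ≤ r) {v : ℂ}
    (hv : ‖v - Function.invFunOn ψ D ζ‖ < infDist (0 : ℂ) Dᶜ * (1 - r) ^ 2 / 64) :
    ∃ ζ' : ℂ, ‖ζ'‖ ≤ (1 + r) / 2 ∧ Function.invFunOn ψ D ζ' = v := by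
  obtain ⟨hsub, -, -⟩ := toolkit_hyps hD hψ
  have hρ₀ := inrad_pos hD
  have hε : 0 < (1 - r) / 2 := by linarith
  have hv' : ‖v - Function.invFunOn ψ D ζ‖ < (1 - r) / 2 * infDist (0 : ℂ) Dᶜ * (1 - r) / 32 := by
    convert hv using 1
    ring
  obtain ⟨ζ', hζ'ζ, -, hFζ'⟩ := KoebeInterior.exists_apply_eq_of_norm_sub_lt
    (hψ.differentiableOn_inv hD.1.1) hψ.injOn_inv hρ₀ hsub hζ hr hε (by linarith) hv'
  refine ⟨ζ', ?_, hFζ'⟩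
  calc ‖ζ'‖ = ‖(ζ' - ζ) + ζ‖ := by rw [sub_add_cancel]
    _ ≤ ‖ζ' - ζ‖ + ‖ζ‖ := norm_add_le _ _
    _ ≤ (1 + r) / 2 := by linarith [hζ'ζ.le]

/-- **Per-step gradient bound at sites Euclidean-close to `ψ⁻¹ ζ`** (Lemma 5.2, `k = 1`, at the
conformal radius `(1+r)/2`): for `h ≥ 0` lattice-harmonic on `V(D)`, `r < 1`,
`inrad(D)(1-r)² ≥ 1.6·10⁵`, `N ≥ 352000·32/(1-r)⁵`, `|ζ| ≤ r` and a site `y` with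
`|y - ψ⁻¹ ζ| < inrad(D)(1-r)²/64`:
`|h(y + e_k) - h(y)| ≤ 4096 C_top (2/c_*)^N h(0)/(inrad(D)(1-r)²)`. [cite: LawlerSchrammWerner2004, Lemma 5.2] -/
theorem abs_step_le_of_norm_sub_lt {h : Site 2 → ℝ} (hpos : ∀ w, 0 ≤ h w)
    (hh : IsLatticeHarmonicOn h (latticeVertices D)) {r : ℝ} (hr : r < 1)
    (hbig : 160000 ≤ infDist (0 : ℂ) Dᶜ * (1 - r) ^ 2) {N : ℕ}
    (hN : 352000 * 32 / (1 - r) ^ 5 ≤ N) {ζ : ℂ} (hζ : ‖ζ‖ ≤ r) {y : Site 2}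
    (hy : ‖Site.toComplex y - Function.invFunOn ψ D ζ‖ < infDist (0 : ℂ) Dᶜ * (1 - r) ^ 2 / 64)
    (k : Fin 4) :
    |h (y + cornerUnit k) - h y| ≤
      4096 * topGradConst * (2 / maneuverConst) ^ N * h 0 / (infDist (0 : ℂ) Dᶜ * (1 - r) ^ 2) := by
  obtain ⟨ζ', hζ', hFζ'⟩ := exists_coord_of_norm_sub_lt hD hψ hr hζ hy
  have h1r : 0 < 1 - r := by linarith
  have hr' : (1 + r) / 2 < 1 := by linarith
  have h1r' : 1 - (1 + r) / 2 = (1 - r) / 2 := by ring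
  have hbig' : 40000 ≤ infDist (0 : ℂ) Dᶜ * (1 - (1 + r) / 2) ^ 2 := by
    rw [h1r']
    nlinarith [hbig]
  have hN' : 352000 / (1 - (1 + r) / 2) ^ 5 ≤ N := by
    rw [h1r']
    have : (352000 : ℝ) / ((1 - r) / 2) ^ 5 = 352000 * 32 / (1 - r) ^ 5 := by
      field_simp
      ring
    rw [this]
    exact hN
  have hx : ‖Site.toComplex y - Function.invFunOn ψ D ζ'‖ ≤ 1 := by
    rw [hFζ', sub_self, norm_zero]
    exact zero_le_one
  have key := lipschitz_isDiscMap_near hD hψ hpos hh hr' hbig' hN' hζ' hx k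
  rw [h1r'] at key
  convert key using 1
  field_simp
  ring

/-- **Conformal displacements control Euclidean ones** (Koebe): for `|ζ|, |ζ'| ≤ r < 1`,
`|ψ⁻¹ ζ - ψ⁻¹ ζ'| ≤ 8 inrad(D) (1-r)⁻³ |ζ - ζ'|` (the obstruction at distance `inrad(D)` bounds
`|(ψ⁻¹)'(0)| ≤ 4 inrad(D)`). [cite: LawlerSchrammWerner2004, §5.1] -/
theorem norm_inv_sub_inv_le {r : ℝ} (hr : r < 1) {ζ ζ' : ℂ} (hζ : ‖ζ‖ ≤ r) (hζ' : ‖ζ'‖ ≤ r) :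
    ‖Function.invFunOn ψ D ζ - Function.invFunOn ψ D ζ'‖ ≤
      8 * infDist (0 : ℂ) Dᶜ / (1 - r) ^ 3 * ‖ζ - ζ'‖ := by
  obtain ⟨-, ⟨b, hb, hbρ⟩, -⟩ := toolkit_hyps hD hψ
  exact KoebeInterior.norm_sub_le_of_norm_le (hψ.differentiableOn_inv hD.1.1) hψ.injOn_inv hb hbρ
    hr hζ hζ'

omit hD hψ in
/-- The sampled site is within `1` of the sampling point. [folklore] -/
theorem norm_toComplex_nearestSite_sub_le (v : ℂ) : ‖Site.toComplex (nearestSite 1 v) - v‖ ≤ 1 := by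
  have h := dist_meshPoint_nearestSite_le one_pos v
  rwa [meshPoint_one, dist_eq_norm] at h

/-- **Variation of `h` between two sampled sites** (the `ℓ¹` staircase inside a Koebe ball): with
`h`, `r`, `N` as in `abs_step_le_of_norm_sub_lt`, `|ζ|, |ζ'| ≤ r`, and
`|ψ⁻¹ ζ' - ψ⁻¹ ζ| ≤ T` with `2T + 8 ≤ inrad(D)(1-r)²/64`:
`|h(site ψ⁻¹ζ') - h(site ψ⁻¹ζ)| ≤ g · 2 (T + 2)`, where
`g = 4096 C_top (2/c_*)^N h(0)/(inrad(D)(1-r)²)` is the per-step bound.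
[cite: LawlerSchrammWerner2004, Lemma 5.3] -/
theorem abs_sample_sub_sample_le {h : Site 2 → ℝ} (hpos : ∀ w, 0 ≤ h w)
    (hh : IsLatticeHarmonicOn h (latticeVertices D)) {r : ℝ} (hr : r < 1)
    (hbig : 160000 ≤ infDist (0 : ℂ) Dᶜ * (1 - r) ^ 2) {N : ℕ}
    (hN : 352000 * 32 / (1 - r) ^ 5 ≤ N) {ζ ζ' : ℂ} (hζ : ‖ζ‖ ≤ r)
    {T : ℝ} (hFT : ‖Function.invFunOn ψ D ζ' - Function.invFunOn ψ D ζ‖ ≤ T)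
    (hT : 2 * T + 8 ≤ infDist (0 : ℂ) Dᶜ * (1 - r) ^ 2 / 64) :
    |h (nearestSite 1 (Function.invFunOn ψ D ζ')) - h (nearestSite 1 (Function.invFunOn ψ D ζ))| ≤
      4096 * topGradConst * (2 / maneuverConst) ^ N * h 0 / (infDist (0 : ℂ) Dᶜ * (1 - r) ^ 2) *
        (2 * (T + 2)) := by
  set F := Function.invFunOn ψ D with hF
  set x : Site 2 := nearestSite 1 (F ζ) with hx
  set x' : Site 2 := nearestSite 1 (F ζ') with hx'
  set g : ℝ := 4096 * topGradConst * (2 / maneuverConst) ^ N * h 0 /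
    (infDist (0 : ℂ) Dᶜ * (1 - r) ^ 2) with hg
  have h1r : 0 < 1 - r := by linarith
  have hρ₀ := inrad_pos hD
  have hg0 : 0 ≤ g := by
    have := topGradConst_pos
    have := maneuverConst_pos
    have := hpos 0
    positivity
  have hxF : ‖Site.toComplex x - F ζ‖ ≤ 1 := norm_toComplex_nearestSite_sub_le _
  have hx'F : ‖Site.toComplex x' - F ζ'‖ ≤ 1 := norm_toComplex_nearestSite_sub_le _
  have hXX : ‖Site.toComplex x' - Site.toComplex x‖ ≤ T + 2 := by
    calc ‖Site.toComplex x' - Site.toComplex x‖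
        = ‖(Site.toComplex x' - F ζ') + (F ζ' - F ζ) + (F ζ - Site.toComplex x)‖ := by ring_nf
      _ ≤ ‖Site.toComplex x' - F ζ'‖ + ‖F ζ' - F ζ‖ + ‖F ζ - Site.toComplex x‖ :=
          norm_add₃_le
      _ ≤ 1 + T + 1 := by rw [norm_sub_rev (F ζ)]; linarith
      _ = T + 2 := by ring
  -- the sup-norm box of integer radius `⌈T + 2⌉` about `x`
  set Rb : ℤ := ⌈T + 2⌉ with hRb
  have hRbT : (T + 2 : ℝ) ≤ Rb := Int.le_ceil _
  have hRbT' : (Rb : ℝ) < T + 3 := by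
    have := Int.ceil_lt_add_one (T + 2)
    linarith
  have hcoord : ∀ z : Site 2, ∀ i : Fin 2,
      |((z i - x i : ℤ) : ℝ)| ≤ ‖Site.toComplex z - Site.toComplex x‖ := by
    intro z i
    fin_cases i
    · have := Complex.abs_re_le_norm (Site.toComplex z - Site.toComplex x)
      simpa using this
    · have := Complex.abs_im_le_norm (Site.toComplex z - Site.toComplex x)
      simpa using this
  have hint : ∀ z : Site 2, ∀ i : Fin 2, ‖Site.toComplex z - Site.toComplex x‖ ≤ T + 2 →
      |z i - x i| ≤ Rb := by
    intro z i hz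
    have h1 : |((z i - x i : ℤ) : ℝ)| ≤ Rb := ((hcoord z i).trans hz).trans hRbT
    rw [← Int.cast_abs] at h1
    exact_mod_cast h1
  -- every site of the box is Euclidean-close to `F ζ`, so the per-step bound holds there
  have hstep : ∀ z : Site 2, |z 0 - x 0| ≤ Rb → |z 1 - x 1| ≤ Rb →
      ∀ k : Fin 4, |h (z + cornerUnit k) - h z| ≤ g := by
    intro z h0 h1 k
    have h0' : |((z 0 - x 0 : ℤ) : ℝ)| ≤ Rb := by rw [← Int.cast_abs]; exact_mod_cast h0
    have h1' : |((z 1 - x 1 : ℤ) : ℝ)| ≤ Rb := by rw [← Int.cast_abs]; exact_mod_cast h1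
    have hZX : ‖Site.toComplex z - Site.toComplex x‖ < 2 * T + 6 := by
      refine (Complex.norm_le_abs_re_add_abs_im _).trans_lt ?_
      have hre : |(Site.toComplex z - Site.toComplex x).re| = |((z 0 - x 0 : ℤ) : ℝ)| := by simp
      have him : |(Site.toComplex z - Site.toComplex x).im| = |((z 1 - x 1 : ℤ) : ℝ)| := by simp
      rw [hre, him]
      linarith
    have hZF : ‖Site.toComplex z - F ζ‖ < infDist (0 : ℂ) Dᶜ * (1 - r) ^ 2 / 64 := by
      calc ‖Site.toComplex z - F ζ‖ = ‖(Site.toComplex z - Site.toComplex x) + (Site.toComplex x - F ζ)‖ := by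
            rw [sub_add_sub_cancel]
        _ ≤ ‖Site.toComplex z - Site.toComplex x‖ + ‖Site.toComplex x - F ζ‖ := norm_add_le _ _
        _ < 2 * T + 6 + 1 := by linarith
        _ ≤ infDist (0 : ℂ) Dᶜ * (1 - r) ^ 2 / 64 := by linarith
    exact abs_step_le_of_norm_sub_lt hD hψ hpos hh hr hbig hN hζ hZF k
  have h0 : |x' 0 - x 0| ≤ Rb := hint x' 0 hXX
  have h1 : |x' 1 - x 1| ≤ Rb := hint x' 1 hXX
  have key := abs_sub_le_of_gradient hstep h0 h1
  refine key.trans ?_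
  refine mul_le_mul_of_nonneg_left ?_ hg0
  have ha := (hcoord x' 0).trans hXX
  have hb := (hcoord x' 1).trans hXX
  linarith

end OneDomain

/-! ### Asymptotic equicontinuity, uniformly over `𝔇` -/

/-- **Asymptotic equicontinuity of the sampled function, uniformly over the class `𝔇`.** For
`0 ≤ r < 1` there is a constant `L = L(r) ≥ 0` such that for every `D ∈ 𝔇` with
`inrad(D)(1-r)² ≥ 1.6·10⁵`, every disc map `ψ` of `D` and every `h ≥ 0` lattice-harmonic on `V(D)`,
`|h(nearestSite 1 (ψ⁻¹ζ)) - h(nearestSite 1 (ψ⁻¹ζ'))| ≤ L h(0) (|ζ - ζ'| + 1/inrad(D))` for all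
`|ζ|, |ζ'| ≤ r` (nearby pairs by the staircase bound, distant pairs by the uniform bound).
[cite: LawlerSchrammWerner2004, Lemma 5.3] -/
theorem exists_equicontinuity_const {r : ℝ} (hr0 : 0 ≤ r) (hr : r < 1) :
    ∃ L : ℝ, 0 ≤ L ∧ ∀ (D : Set ℂ), IsClassD D → ∀ (ψ : ℂ → ℂ), IsDiscMap D ψ →
      ∀ (h : Site 2 → ℝ), (∀ w, 0 ≤ h w) → IsLatticeHarmonicOn h (latticeVertices D) →
      160000 ≤ infDist (0 : ℂ) Dᶜ * (1 - r) ^ 2 →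
      ∀ ζ ζ' : ℂ, ‖ζ‖ ≤ r → ‖ζ'‖ ≤ r →
        |h (nearestSite 1 (Function.invFunOn ψ D ζ)) -
            h (nearestSite 1 (Function.invFunOn ψ D ζ'))| ≤
          L * h 0 * (‖ζ - ζ'‖ + (infDist (0 : ℂ) Dᶜ)⁻¹) := by
  have h1r : 0 < 1 - r := by linarith
  have hc := maneuverConst_pos
  have hK := topGradConst_pos
  -- the exponents of Lemma 5.2
  set N₀ : ℕ := ⌈(11000 : ℝ) / (1 - r) ^ 5⌉₊ with hN₀
  set N₁ : ℕ := ⌈(352000 * 32 : ℝ) / (1 - r) ^ 5⌉₊ with hN₁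
  have hN₀' : (11000 : ℝ) / (1 - r) ^ 5 ≤ N₀ := Nat.le_ceil _
  have hN₁' : (352000 * 32 : ℝ) / (1 - r) ^ 5 ≤ N₁ := Nat.le_ceil _
  -- constants: per-step `A h0 / R`, Euclidean/conformal ratio `M R`, sup bound `B h0`, threshold `κ`
  set A : ℝ := 4096 * topGradConst * (2 / maneuverConst) ^ N₁ / (1 - r) ^ 2 with hA
  set M : ℝ := 8 / (1 - r) ^ 3 with hM
  set B : ℝ := (2 / maneuverConst) ^ N₀ with hB
  set κ : ℝ := (1 - r) ^ 5 / 2048 with hκ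
  have hA0 : 0 ≤ A := by positivity
  have hM8 : 8 ≤ M := by
    rw [hM, le_div_iff₀ (by positivity)]
    have : (1 - r) ^ 3 ≤ 1 := pow_le_one₀ h1r.le (by linarith)
    nlinarith
  have hM0 : 0 < M := by linarith
  have hB0 : 0 ≤ B := by positivity
  have hκ0 : 0 < κ := by positivity
  refine ⟨2 * A * M + 2 * B / κ, by positivity, ?_⟩
  intro D hD ψ hψ h hpos hh hbig ζ ζ' hζ hζ'
  set R : ℝ := infDist (0 : ℂ) Dᶜ with hR
  have hR0 : 0 < R := inrad_pos hD
  have h00 : 0 ≤ h 0 := hpos 0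
  have hbig₀ : 10000 ≤ R * (1 - r) ^ 2 := by linarith
  -- Euclidean displacement
  have hdisp : ‖Function.invFunOn ψ D ζ' - Function.invFunOn ψ D ζ‖ ≤ M * R * ‖ζ - ζ'‖ := by
    have h1 := norm_inv_sub_inv_le hD hψ hr hζ' hζ
    rw [norm_sub_rev ζ' ζ] at h1
    convert h1 using 1
    rw [hM, hR]
    ring
  by_cases hnear : 2 * (M * R * ‖ζ - ζ'‖) + 8 ≤ R * (1 - r) ^ 2 / 64
  · -- nearby pair: staircase bound
    have key := abs_sample_sub_sample_le hD hψ hpos hh hr hbig hN₁' hζ hdisp hnear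
    rw [abs_sub_comm] at key
    refine key.trans ?_
    have hcalc : 4096 * topGradConst * (2 / maneuverConst) ^ N₁ * h 0 / (R * (1 - r) ^ 2) *
        (2 * (M * R * ‖ζ - ζ'‖ + 2)) = 2 * A * h 0 * (M * ‖ζ - ζ'‖ + 2 * R⁻¹) := by
      rw [hA]
      field_simp
    rw [hcalc]
    have h2 : M * ‖ζ - ζ'‖ + 2 * R⁻¹ ≤ M * (‖ζ - ζ'‖ + R⁻¹) := by
      rw [mul_add]
      have : 2 * R⁻¹ ≤ M * R⁻¹ := mul_le_mul_of_nonneg_right (by linarith) (by positivity)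
      linarith
    calc 2 * A * h 0 * (M * ‖ζ - ζ'‖ + 2 * R⁻¹) ≤ 2 * A * h 0 * (M * (‖ζ - ζ'‖ + R⁻¹)) :=
          mul_le_mul_of_nonneg_left h2 (by positivity)
      _ = 2 * A * M * h 0 * (‖ζ - ζ'‖ + R⁻¹) := by ring
      _ ≤ (2 * A * M + 2 * B / κ) * h 0 * (‖ζ - ζ'‖ + R⁻¹) := by
          have : 0 ≤ 2 * B / κ * h 0 * (‖ζ - ζ'‖ + R⁻¹) := by positivity
          nlinarith
  · -- distant pair: `‖ζ - ζ'‖ ≥ κ`, use the uniform bound twice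
    push Not at hnear
    have hfar : κ ≤ ‖ζ - ζ'‖ := by
      -- `R(1-r)²/64 - 8 ≥ R(1-r)²/128` since `R(1-r)² ≥ 1024`
      have h1 : R * (1 - r) ^ 2 / 128 ≤ 2 * (M * R * ‖ζ - ζ'‖) := by linarith
      -- `κ = (1-r)²/(256 M)`:  `(1-r)^5/2048 * (2 * M) = (1-r)²/128 * ... `
      have h2 : R * (1 - r) ^ 2 / 128 = 2 * (M * R * κ) := by
        rw [hM, hκ]
        field_simp
        ring
      rw [h2] at h1
      have h3 : 0 < 2 * (M * R) := by positivity
      nlinarith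
    have hu := sample_le hD hψ hpos hh hr hbig₀ hN₀' hζ
    have hu' := sample_le hD hψ hpos hh hr hbig₀ hN₀' hζ'
    have hnn := hpos (nearestSite 1 (Function.invFunOn ψ D ζ))
    have hnn' := hpos (nearestSite 1 (Function.invFunOn ψ D ζ'))
    have habs : |h (nearestSite 1 (Function.invFunOn ψ D ζ)) -
        h (nearestSite 1 (Function.invFunOn ψ D ζ'))| ≤ 2 * B * h 0 := by
      rw [abs_le]
      constructor <;> linarith
    refine habs.trans ?_
    have h4 : 2 * B * h 0 ≤ 2 * B / κ * h 0 * ‖ζ - ζ'‖ := by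
      have : 2 * B * h 0 = 2 * B / κ * h 0 * κ := by field_simp
      rw [this]
      exact mul_le_mul_of_nonneg_left hfar (by positivity)
    calc 2 * B * h 0 ≤ 2 * B / κ * h 0 * ‖ζ - ζ'‖ := h4
      _ ≤ 2 * B / κ * h 0 * (‖ζ - ζ'‖ + R⁻¹) := by
          refine mul_le_mul_of_nonneg_left ?_ (by positivity)
          linarith [inv_nonneg.2 hR0.le]
      _ ≤ (2 * A * M + 2 * B / κ) * h 0 * (‖ζ - ζ'‖ + R⁻¹) := by
          have : 0 ≤ 2 * A * M * h 0 * (‖ζ - ζ'‖ + R⁻¹) := by positivity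
          nlinarith

/-! ### Extraction of a continuous subsequential limit in conformal coordinates -/

/-- A compact subset of the open unit disc lies in a closed disc of radius `r ∈ [0, 1)`. [folklore] -/
theorem exists_subset_closedBall_of_isCompact {K : Set ℂ} (hK : IsCompact K) (hK1 : K ⊆ ball 0 1) :
    ∃ r : ℝ, 0 ≤ r ∧ r < 1 ∧ K ⊆ closedBall (0 : ℂ) r := by
  rcases K.eq_empty_or_nonempty with rfl | hne
  · exact ⟨0, le_rfl, one_pos, empty_subset _⟩
  · obtain ⟨z₀, hz₀, hmax⟩ := hK.exists_isMaxOn hne continuous_norm.continuousOn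
    exact ⟨‖z₀‖, norm_nonneg _, mem_ball_zero_iff.1 (hK1 hz₀),
      fun z hz => mem_closedBall_zero_iff.2 (hmax hz)⟩

/-- **Extraction (the Arzelà–Ascoli step of Lemma 5.3, in conformal coordinates).** Let
`D_n ∈ 𝔇` with disc maps `ψ_n`, `h_n ≥ 0` lattice-harmonic on `V(D_n)` with `h_n(0) = 1`, and
`inrad(D_n) → ∞`. Then along a subsequence the sampled functions
`ζ ↦ h_n(nearestSite 1 (ψ_n⁻¹ ζ))` converge uniformly on every compact subset of `𝔻` to a function
continuous on `𝔻` (uniform bound `sample_le`, asymptotic equicontinuity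
`exists_equicontinuity_const`, and `exists_subseq_tendstoUniformlyOn_of_asympEquicontinuous`).
[cite: LawlerSchrammWerner2004, Lemma 5.3] -/
theorem exists_subseq_tendstoUniformlyOn_sample {Dn : ℕ → Set ℂ} (hDn : ∀ n, IsClassD (Dn n))
    {ψn : ℕ → ℂ → ℂ} (hψn : ∀ n, IsDiscMap (Dn n) (ψn n)) {hn : ℕ → Site 2 → ℝ}
    (hpos : ∀ n w, 0 ≤ hn n w) (hharm : ∀ n, IsLatticeHarmonicOn (hn n) (latticeVertices (Dn n)))
    (h0 : ∀ n, hn n 0 = 1) (hR : Tendsto (fun n => infDist (0 : ℂ) (Dn n)ᶜ) atTop atTop) :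
    ∃ φ : ℕ → ℕ, StrictMono φ ∧ ∃ g : ℂ → ℝ, ContinuousOn g (ball 0 1) ∧
      ∀ K ⊆ ball (0 : ℂ) 1, IsCompact K →
        TendstoUniformlyOn
          (fun n ζ => hn (φ n) (nearestSite 1 (Function.invFunOn (ψn (φ n)) (Dn (φ n)) ζ)))
          g atTop K := by
  -- the sampled functions as complex-valued functions, and the vanishing scale `1/inrad(D_n)`
  set u : ℕ → ℂ → ℂ := fun n ζ =>
    ((hn n (nearestSite 1 (Function.invFunOn (ψn n) (Dn n) ζ)) : ℝ) : ℂ) with hu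
  set ε : ℕ → ℝ := fun n => (infDist (0 : ℂ) (Dn n)ᶜ)⁻¹ with hε
  have hε0 : Tendsto ε atTop (𝓝 0) := tendsto_inv_atTop_zero.comp hR
  -- eventual uniform bound on compacta
  have hbdd : ∀ K ⊆ ball (0 : ℂ) 1, IsCompact K → ∃ M : ℝ, ∀ᶠ n in atTop, ∀ z ∈ K, ‖u n z‖ ≤ M := by
    intro K hK1 hK
    obtain ⟨r, hr0, hr1, hKr⟩ := exists_subset_closedBall_of_isCompact hK hK1
    have h1r : 0 < 1 - r := by linarith
    set N₀ : ℕ := ⌈(11000 : ℝ) / (1 - r) ^ 5⌉₊ with hN₀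
    have hN₀' : (11000 : ℝ) / (1 - r) ^ 5 ≤ N₀ := Nat.le_ceil _
    refine ⟨(2 / maneuverConst) ^ N₀, ?_⟩
    filter_upwards [hR.eventually_ge_atTop (10000 / (1 - r) ^ 2)] with n hn' z hz
    have hbig : 10000 ≤ infDist (0 : ℂ) (Dn n)ᶜ * (1 - r) ^ 2 := by
      rw [div_le_iff₀ (by positivity)] at hn'
      exact hn'
    have hζ : ‖z‖ ≤ r := mem_closedBall_zero_iff.1 (hKr hz)
    have key := sample_le (hDn n) (hψn n) (hpos n) (hharm n) hr1 hbig hN₀' hζ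
    rw [h0 n, mul_one] at key
    rw [hu]
    simp only [Complex.norm_real, Real.norm_eq_abs, abs_of_nonneg (hpos n _)]
    exact key
  -- eventual asymptotic equicontinuity on compacta
  have hequi : ∀ K ⊆ ball (0 : ℂ) 1, IsCompact K → ∃ L : ℝ, 0 ≤ L ∧ ∀ᶠ n in atTop,
      ∀ z ∈ K, ∀ z' ∈ K, ‖u n z - u n z'‖ ≤ L * (‖z - z'‖ + ε n) := by
    intro K hK1 hK
    obtain ⟨r, hr0, hr1, hKr⟩ := exists_subset_closedBall_of_isCompact hK hK1
    have h1r : 0 < 1 - r := by linarith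
    obtain ⟨L, hL0, hL⟩ := exists_equicontinuity_const hr0 hr1
    refine ⟨L, hL0, ?_⟩
    filter_upwards [hR.eventually_ge_atTop (160000 / (1 - r) ^ 2)] with n hn' z hz z' hz'
    have hbig : 160000 ≤ infDist (0 : ℂ) (Dn n)ᶜ * (1 - r) ^ 2 := by
      rw [div_le_iff₀ (by positivity)] at hn'
      exact hn'
    have key := hL (Dn n) (hDn n) (ψn n) (hψn n) (hn n) (hpos n) (hharm n) hbig z z'
      (mem_closedBall_zero_iff.1 (hKr hz)) (mem_closedBall_zero_iff.1 (hKr hz'))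
    rw [h0 n, mul_one] at key
    rw [hu, hε]
    simp only [← Complex.ofReal_sub, Complex.norm_real, Real.norm_eq_abs]
    exact key
  obtain ⟨φ, hφ, g, hgc, hg⟩ :=
    exists_subseq_tendstoUniformlyOn_of_asympEquicontinuous isOpen_ball u ε hε0 hbdd hequi
  refine ⟨φ, hφ, fun ζ => (g ζ).re, Complex.continuous_re.comp_continuousOn hgc, ?_⟩
  intro K hK1 hK
  have h := hg K hK1 hK
  rw [Metric.tendstoUniformlyOn_iff] at h ⊢
  intro δ hδ
  filter_upwards [h δ hδ] with n hn' ζ hζ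
  have h1 := hn' ζ hζ
  rw [dist_eq_norm] at h1
  rw [Real.dist_eq]
  refine lt_of_le_of_lt ?_ h1
  have h2 : (g ζ).re - hn (φ n) (nearestSite 1 (Function.invFunOn (ψn (φ n)) (Dn (φ n)) ζ)) =
      (g ζ - u (φ n) ζ).re := by
    rw [hu]
    simp
  rw [h2]
  exact Complex.abs_re_le_norm _

/-! ### The subsequential limit is harmonic -/

/-- **The rescaled inverse map `ζ ↦ ψ⁻¹(ζ)/inrad(D)`** is univalent on `𝔻`, vanishes at `0`, and
has `1 ≤ |derivative at 0| ≤ 4` (Schwarz and Koebe, `KoebeInterior.le_norm_deriv_zero`,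
`KoebeInterior.norm_deriv_zero_le`). [cite: LawlerSchrammWerner2004, §5.1] -/
theorem scaledInv_props {D : Set ℂ} (hD : IsClassD D) {ψ : ℂ → ℂ} (hψ : IsDiscMap D ψ) :
    DifferentiableOn ℂ (fun ζ => ((infDist (0 : ℂ) Dᶜ : ℝ) : ℂ)⁻¹ * Function.invFunOn ψ D ζ)
        (ball 0 1) ∧
      InjOn (fun ζ => ((infDist (0 : ℂ) Dᶜ : ℝ) : ℂ)⁻¹ * Function.invFunOn ψ D ζ) (ball 0 1) ∧
      ((infDist (0 : ℂ) Dᶜ : ℝ) : ℂ)⁻¹ * Function.invFunOn ψ D 0 = 0 ∧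
      1 ≤ ‖deriv (fun ζ => ((infDist (0 : ℂ) Dᶜ : ℝ) : ℂ)⁻¹ * Function.invFunOn ψ D ζ) 0‖ ∧
      ‖deriv (fun ζ => ((infDist (0 : ℂ) Dᶜ : ℝ) : ℂ)⁻¹ * Function.invFunOn ψ D ζ) 0‖ ≤ 4 := by
  have hR := inrad_pos hD
  have hRc : ((infDist (0 : ℂ) Dᶜ : ℝ) : ℂ) ≠ 0 := Complex.ofReal_ne_zero.2 hR.ne'
  have hFd := hψ.differentiableOn_inv hD.1.1
  obtain ⟨hsub, ⟨b, hb, hbρ⟩, -⟩ := toolkit_hyps hD hψ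
  have hdiff0 : DifferentiableAt ℂ (Function.invFunOn ψ D) 0 :=
    hFd.differentiableAt (ball_mem_nhds 0 one_pos)
  have hder : deriv (fun ζ => ((infDist (0 : ℂ) Dᶜ : ℝ) : ℂ)⁻¹ * Function.invFunOn ψ D ζ) 0 =
      ((infDist (0 : ℂ) Dᶜ : ℝ) : ℂ)⁻¹ * deriv (Function.invFunOn ψ D) 0 := deriv_const_mul _ hdiff0
  have hnorm : ‖deriv (fun ζ => ((infDist (0 : ℂ) Dᶜ : ℝ) : ℂ)⁻¹ * Function.invFunOn ψ D ζ) 0‖ =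
      (infDist (0 : ℂ) Dᶜ)⁻¹ * ‖deriv (Function.invFunOn ψ D) 0‖ := by
    rw [hder, norm_mul, norm_inv, Complex.norm_real, Real.norm_eq_abs, abs_of_pos hR]
  have hlo := KoebeInterior.le_norm_deriv_zero hFd hψ.injOn_inv hR hsub
  have hhi := KoebeInterior.norm_deriv_zero_le hFd hψ.injOn_inv hb hbρ
  refine ⟨hFd.const_mul _, fun x hx y hy hxy => hψ.injOn_inv hx hy (mul_left_cancel₀ (inv_ne_zero hRc) hxy),
    by rw [hψ.inv_zero hD.2.2.1, mul_zero], ?_, ?_⟩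
  · rw [hnorm, le_inv_mul_iff₀ hR, mul_one]
    exact hlo
  · rw [hnorm, inv_mul_le_iff₀ hR]
    linarith

/-- **The subsequential limit in conformal coordinates is harmonic** (the "`h*` is harmonic" step
of Lemma 5.3, arXiv p. 28: "The fact that `h^n` is discrete-harmonic translates to
`(∂_x^δ)² h^n(v-δ) + (∂_y^δ)² h^n(v-iδ) = 0`. Therefore [the convergence of discrete derivatives]
shows that `h*` is harmonic"; here via the tree's consistency-and-stability theorem
`harmonicOnNhd_of_latticeHarmonic_limit` in the Euclidean picture of a Montel limit `Φ` of
`ψ_n⁻¹/inrad(D_n)`). Let `D_n ∈ 𝔇` with disc maps `ψ_n`, `h_n ≥ 0` lattice-harmonic on `V(D_n)`,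
`inrad(D_n) → ∞`, and suppose the sampled functions `ζ ↦ h_n(nearestSite 1 (ψ_n⁻¹ ζ))` converge
uniformly on compact subsets of `𝔻` to `g`, continuous on `𝔻`. Then `g` is harmonic on `𝔻`.
[cite: LawlerSchrammWerner2004, Lemma 5.3] -/
theorem harmonicOnNhd_of_sample_limit {Dn : ℕ → Set ℂ} (hDn : ∀ n, IsClassD (Dn n))
    {ψn : ℕ → ℂ → ℂ} (hψn : ∀ n, IsDiscMap (Dn n) (ψn n)) {hn : ℕ → Site 2 → ℝ}
    (hharm : ∀ n, IsLatticeHarmonicOn (hn n) (latticeVertices (Dn n)))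
    (hR : Tendsto (fun n => infDist (0 : ℂ) (Dn n)ᶜ) atTop atTop)
    {g : ℂ → ℝ} (hgc : ContinuousOn g (ball 0 1))
    (hg : ∀ K ⊆ ball (0 : ℂ) 1, IsCompact K →
      TendstoUniformlyOn
        (fun n ζ => hn n (nearestSite 1 (Function.invFunOn (ψn n) (Dn n) ζ))) g atTop K) :
    InnerProductSpace.HarmonicOnNhd g (ball 0 1) := by
  -- notation
  set R : ℕ → ℝ := fun n => infDist (0 : ℂ) (Dn n)ᶜ with hRdef
  set F : ℕ → ℂ → ℂ := fun n => Function.invFunOn (ψn n) (Dn n) with hFdef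
  set G : ℕ → ℂ → ℂ := fun n ζ => ((R n : ℝ) : ℂ)⁻¹ * F n ζ with hGdef
  have hRpos : ∀ n, 0 < R n := fun n => inrad_pos (hDn n)
  have hGp : ∀ n, DifferentiableOn ℂ (G n) (ball 0 1) ∧ InjOn (G n) (ball 0 1) ∧ G n 0 = 0 ∧
      1 ≤ ‖deriv (G n) 0‖ ∧ ‖deriv (G n) 0‖ ≤ 4 := fun n => scaledInv_props (hDn n) (hψn n)
  -- Montel: a univalent locally uniform limit `Φ` of a subsequence of the rescaled inverse maps
  obtain ⟨φ, hφ, Φ, hΦd, hΦinj, -, -, -, hlim, -⟩ :=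
    exists_subseq_tendstoLocallyUniformlyOn_univalent (fun n => (hGp n).1) (fun n => (hGp n).2.1)
      (fun n => (hGp n).2.2.1) one_pos (fun n => (hGp n).2.2.2.1) (fun n => (hGp n).2.2.2.2)
  -- the limit domain and the inverse of `Φ`
  set Ω : Set ℂ := Φ '' ball 0 1 with hΩdef
  have hΩ : IsOpen Ω := SCV.isOpen_image_of_injOn rfl hΦd isOpen_ball hΦinj
  set Φi : ℂ → ℂ := Function.invFunOn Φ (ball 0 1) with hΦidef
  have hΦi_d : DifferentiableOn ℂ Φi Ω :=
    Complex.differentiableOn_invFunOn_image isOpen_ball hΦd hΦinj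
      (fun z hz => SCV.deriv_ne_zero_of_injOn hΦd isOpen_ball hΦinj hz)
  have hΦi_c : ContinuousOn Φi Ω := hΦi_d.continuousOn
  have hleft : ∀ ζ ∈ ball (0 : ℂ) 1, Φi (Φ ζ) = ζ := fun ζ hζ => hΦinj.leftInvOn_invFunOn hζ
  have hright : ∀ z ∈ Ω, Φ (Φi z) = z := fun z hz => (surjOn_image Φ (ball 0 1)).rightInvOn_invFunOn hz
  have hmaps : MapsTo Φi Ω (ball 0 1) := (surjOn_image Φ (ball 0 1)).mapsTo_invFunOn
  -- `H = g ∘ Φ⁻¹`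
  set H : ℂ → ℝ := fun z => g (Φi z) with hHdef
  have hHc : ContinuousOn H Ω := hgc.comp hΦi_c hmaps
  -- uniform convergence of `G ∘ φ` to `Φ` on compacta, and along shifted subsequences
  have hGunif : ∀ K ⊆ ball (0 : ℂ) 1, IsCompact K →
      TendstoUniformlyOn (fun n => G (φ n)) Φ atTop K :=
    (tendstoLocallyUniformlyOn_iff_forall_isCompact isOpen_ball).1 hlim
  -- `H` is harmonic on `Ω`
  have hH : InnerProductSpace.HarmonicOnNhd H Ω := by
    intro z₀ hz₀
    obtain ⟨ρ', hρ', hballΩ⟩ := Metric.isOpen_iff.1 hΩ z₀ hz₀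
    set ρ : ℝ := ρ' / 2 with hρdef
    have hρ : 0 < ρ := by positivity
    have hKΩ : closedBall z₀ ρ ⊆ Ω := (closedBall_subset_ball (by linarith)).trans hballΩ
    suffices hsuff : InnerProductSpace.HarmonicOnNhd H (ball z₀ ρ) from hsuff z₀ (mem_ball_self hρ)
    -- conformal coordinates of the closed disc: a compact `L' ⊆ closedBall 0 r₁`, `r₁ < 1`
    set K : Set ℂ := closedBall z₀ ρ with hKdef
    have hKc : IsCompact K := isCompact_closedBall _ _
    have hL'c : IsCompact (Φi '' K) := hKc.image_of_continuousOn (hΦi_c.mono hKΩ)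
    have hL'1 : Φi '' K ⊆ ball 0 1 := (hmaps.mono_left hKΩ).image_subset
    obtain ⟨r₁, hr₁0, hr₁1, hL'r⟩ := exists_subset_closedBall_of_isCompact hL'c hL'1
    set r' : ℝ := (1 + r₁) / 2 with hr'def
    have hr'1 : r' < 1 := by rw [hr'def]; linarith
    have hr₁r' : r₁ < r' := by rw [hr'def]; linarith
    have hcb' : closedBall (0 : ℂ) r' ⊆ ball 0 1 := closedBall_subset_ball hr'1
    have hKΦ : K ⊆ Φ '' closedBall 0 r₁ := fun z hz => ⟨Φi z, hL'r ⟨z, hz, rfl⟩, hright z (hKΩ hz)⟩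
    -- kernel inclusion: eventually `Φ(B̄ r₁) ⊆ G_{φ k}(B r')`
    have hK3 : ∀ᶠ k in atTop, Φ '' closedBall 0 r₁ ⊆ G (φ k) '' ball 0 r' :=
      eventually_image_closedBall_subset_image (Eventually.of_forall fun k => (hGp (φ k)).1)
        hΦd.continuousOn hΦinj hlim hr₁0 hr₁r' hr'1
    obtain ⟨N₀, hN₀⟩ := eventually_atTop.1 hK3
    -- the shifted subsequence `ι m = φ (m + N₀)`
    set ι : ℕ → ℕ := fun m => φ (m + N₀) with hιdef
    have hι : Tendsto ι atTop atTop := hφ.tendsto_atTop.comp (tendsto_add_atTop_nat N₀)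
    have hincl : ∀ m, K ⊆ G (ι m) '' ball 0 r' := fun m =>
      hKΦ.trans (hN₀ (m + N₀) (Nat.le_add_left _ _))
    set δ : ℕ → ℝ := fun m => (R (ι m))⁻¹ with hδdef
    have hδ : ∀ m, 0 < δ m := fun m => inv_pos.2 (hRpos _)
    have hδ0 : Tendsto δ atTop (𝓝 0) := tendsto_inv_atTop_zero.comp (hR.comp hι)
    -- mesh points of `K` are rescaled lattice points of `D`, with conformal coordinate in `B r'`
    have hmesh : ∀ m (v : Site 2), meshPoint (δ m) v ∈ K →
        ∃ ζ : ℂ, ‖ζ‖ < r' ∧ F (ι m) ζ = Site.toComplex v ∧ G (ι m) ζ = meshPoint (δ m) v := by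
      intro m v hv
      obtain ⟨ζ, hζ, hGζ⟩ := hincl m hv
      refine ⟨ζ, mem_ball_zero_iff.1 hζ, ?_, hGζ⟩
      have hRc : ((R (ι m) : ℝ) : ℂ) ≠ 0 := Complex.ofReal_ne_zero.2 (hRpos _).ne'
      have h1 : ((R (ι m) : ℝ) : ℂ)⁻¹ * F (ι m) ζ = ((R (ι m) : ℝ) : ℂ)⁻¹ * Site.toComplex v := by
        have h2 : G (ι m) ζ = ((R (ι m) : ℝ) : ℂ)⁻¹ * F (ι m) ζ := rfl
        rw [← h2, hGζ, meshPoint, hδdef, Complex.ofReal_inv]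
      exact mul_left_cancel₀ (inv_ne_zero hRc) h1
    have hvert : ∀ m (v : Site 2), meshPoint (δ m) v ∈ K → v ∈ latticeVertices (Dn (ι m)) := by
      intro m v hv
      obtain ⟨ζ, hζ, hFζ, -⟩ := hmesh m v hv
      have h1 : F (ι m) ζ ∈ Dn (ι m) :=
        (hψn (ι m)).mapsTo_inv (mem_ball_zero_iff.2 (hζ.trans hr'1))
      rw [hFζ] at h1
      exact h1
    -- consistency and stability on the disc
    refine harmonicOnNhd_of_latticeHarmonic_limit hρ (hHc.mono hKΩ) hδ hδ0
      (u := fun m => hn (ι m)) ?_ ?_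
    · intro m v hv
      exact hharm (ι m) v (hvert m v (ball_subset_closedBall hv))
    · intro ε hε
      -- uniform continuity of `g` on `B̄ r'` and of `Φ⁻¹` on `Φ(B̄ r')`
      have hKt : IsCompact (Φ '' closedBall 0 r') :=
        (isCompact_closedBall (0 : ℂ) r').image_of_continuousOn (hΦd.continuousOn.mono hcb')
      have hKtΩ : Φ '' closedBall 0 r' ⊆ Ω := image_mono hcb'
      obtain ⟨η, hη, hgu⟩ := Metric.uniformContinuousOn_iff.1
        ((isCompact_closedBall (0 : ℂ) r').uniformContinuousOn_of_continuous (hgc.mono hcb'))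
        (ε / 2) (by positivity)
      obtain ⟨θ, hθ, hΦu⟩ := Metric.uniformContinuousOn_iff.1
        (hKt.uniformContinuousOn_of_continuous (hΦi_c.mono hKtΩ)) η hη
      -- eventually: samples within `ε/2` of `g`, and `G` within `θ` of `Φ`, on `B̄ r'`
      have h1 : ∀ᶠ m in atTop, ∀ ζ ∈ closedBall (0 : ℂ) r',
          dist (g ζ) (hn (ι m) (nearestSite 1 (F (ι m) ζ))) < ε / 2 :=
        hι.eventually (Metric.tendstoUniformlyOn_iff.1
          (hg _ hcb' (isCompact_closedBall _ _)) (ε / 2) (by positivity))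
      have h2 : ∀ᶠ m in atTop, ∀ ζ ∈ closedBall (0 : ℂ) r', dist (Φ ζ) (G (ι m) ζ) < θ :=
        (tendsto_add_atTop_nat N₀).eventually (Metric.tendstoUniformlyOn_iff.1
          (hGunif _ hcb' (isCompact_closedBall _ _)) θ hθ)
      filter_upwards [h1, h2] with m hm1 hm2 v hv
      obtain ⟨ζ, hζr', hFζ, hGζ⟩ := hmesh m v hv
      have hζcb : ζ ∈ closedBall (0 : ℂ) r' := mem_closedBall_zero_iff.2 hζr'.le
      -- the sample at `ζ` is the value at `v`
      have hs := hm1 ζ hζcb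
      rw [hFζ, nearestSite_one_toComplex] at hs
      -- `Φ⁻¹` of the mesh point is close to `ζ`
      have hmemK : meshPoint (δ m) v ∈ Φ '' closedBall 0 r' :=
        (hKΦ.trans (image_mono (closedBall_subset_closedBall hr₁r'.le))) hv
      have hΦζ : Φ ζ ∈ Φ '' closedBall 0 r' := mem_image_of_mem Φ hζcb
      have hd1 : dist (meshPoint (δ m) v) (Φ ζ) < θ := by
        rw [← hGζ, dist_comm]
        exact hm2 ζ hζcb
      have hd2 := hΦu _ hmemK _ hΦζ hd1
      rw [hleft ζ (hcb' hζcb)] at hd2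
      have hΦiK : Φi (meshPoint (δ m) v) ∈ closedBall (0 : ℂ) r' :=
        closedBall_subset_closedBall hr₁r'.le (hL'r ⟨_, hv, rfl⟩)
      have hd3 := hgu _ hΦiK _ hζcb hd2
      -- assemble
      rw [Real.dist_eq] at hs hd3
      have hs' : |hn (ι m) v - g ζ| < ε / 2 := by rwa [abs_sub_comm] at hs
      have hd3' : |g ζ - g (Φi (meshPoint (δ m) v))| < ε / 2 := by rwa [abs_sub_comm] at hd3
      have htri := abs_sub_le (hn (ι m) v) (g ζ) (g (Φi (meshPoint (δ m) v)))
      change |hn (ι m) v - g (Φi (meshPoint (δ m) v))| ≤ ε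
      linarith
  -- `g = H ∘ Φ` on the disc, and harmonic ∘ holomorphic is harmonic
  have hcomp : InnerProductSpace.HarmonicOnNhd (fun ζ => H (Φ ζ)) (ball 0 1) :=
    harmonicOnNhd_comp_of_differentiableOn hH hΩ hΦd isOpen_ball (mapsTo_image Φ _)
  intro ζ hζ
  have hev : g =ᶠ[𝓝 ζ] fun ζ => H (Φ ζ) := by
    filter_upwards [isOpen_ball.mem_nhds hζ] with ζ' hζ'
    show g ζ' = g (Φi (Φ ζ'))
    rw [hleft ζ' hζ']
  exact (InnerProductSpace.harmonicAt_congr_nhds hev).2 (hcomp ζ hζ)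

/-! ### Lemma 5.3: continuous harmonic approximation -/

/-- **Lemma 5.3 for normalised functions** (`h(0) = 1`): for every `ε > 0` there is `r₀ > 0` such
that for every `D ∈ 𝔇` with `inrad(D) ≥ r₀`, every disc map `ψ` of `D` and every `h ≥ 0`
lattice-harmonic on `V(D)` with `h(0) = 1`, some harmonic `h* ≥ 0` on `D` has
`|h*(v) - h(v)| ≤ ε` at all `v ∈ V(D)` with `|ψ(v)| < 1 - ε`. Proof by contradiction: a sequence
of counterexamples with `inrad → ∞` has, along a subsequence, sampled functions converging on
compacta of `𝔻` to a continuous `g ≥ 0` (`exists_subseq_tendstoUniformlyOn_sample`), which is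
harmonic (`harmonicOnNhd_of_sample_limit`); then `h* = g ∘ ψ_n` is admissible for large `n`.
[cite: LawlerSchrammWerner2004, Lemma 5.3] -/
theorem continuousHarmonicApproximation_normalised (ε : ℝ) (hε : 0 < ε) :
    ∃ r₀ : ℝ, 0 < r₀ ∧ ∀ D : Set ℂ, IsClassD D → r₀ ≤ infDist (0 : ℂ) Dᶜ →
      ∀ ψ : ℂ → ℂ, IsDiscMap D ψ → ∀ h : Site 2 → ℝ, (∀ w, 0 ≤ h w) →
        IsLatticeHarmonicOn h (latticeVertices D) → h 0 = 1 →
        ∃ hstar : ℂ → ℝ, InnerProductSpace.HarmonicOnNhd hstar D ∧ (∀ z ∈ D, 0 ≤ hstar z) ∧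
          ∀ v ∈ latticeVertices D, ‖ψ (Site.toComplex v)‖ < 1 - ε →
            |hstar (Site.toComplex v) - h v| ≤ ε := by
  by_contra hcon
  push Not at hcon
  -- counterexamples at every inner radius `n + 1`
  choose D hD hRD ψ hψ h hpos hharm h0 hfail using fun n : ℕ => hcon ((n : ℝ) + 1) (by positivity)
  have hR : Tendsto (fun n => infDist (0 : ℂ) (D n)ᶜ) atTop atTop := by
    refine tendsto_atTop_mono hRD ?_
    exact tendsto_atTop_add_const_right _ 1 tendsto_natCast_atTop_atTop
  -- extraction and harmonicity of the limit
  obtain ⟨φ, hφ, g, hgc, hg⟩ := exists_subseq_tendstoUniformlyOn_sample hD hψ hpos hharm h0 hR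
  have hgharm : InnerProductSpace.HarmonicOnNhd g (ball 0 1) :=
    harmonicOnNhd_of_sample_limit (fun n => hD (φ n)) (fun n => hψ (φ n)) (fun n => hharm (φ n))
      (hR.comp hφ.tendsto_atTop) hgc hg
  have hgnn : ∀ ζ ∈ ball (0 : ℂ) 1, 0 ≤ g ζ := by
    intro ζ hζ
    have ht : Tendsto (fun n => h (φ n) (nearestSite 1 (Function.invFunOn (ψ (φ n)) (D (φ n)) ζ)))
        atTop (𝓝 (g ζ)) :=
      ((hg {ζ} (singleton_subset_iff.2 hζ) isCompact_singleton).tendsto_at (mem_singleton ζ))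
    exact ge_of_tendsto' ht fun n => hpos _ _
  -- uniform closeness on the closed disc of radius `1 - ε`, at some index `k`
  have hcb : closedBall (0 : ℂ) (1 - ε) ⊆ ball 0 1 := closedBall_subset_ball (by linarith)
  obtain ⟨k, hk⟩ := eventually_atTop.1 (Metric.tendstoUniformlyOn_iff.1
    (hg _ hcb (isCompact_closedBall _ _)) ε hε)
  have hk' := hk k le_rfl
  -- the candidate `h* = g ∘ ψ_{φ k}`
  set n := φ k with hn
  have hstar_harm : InnerProductSpace.HarmonicOnNhd (fun z => g (ψ n z)) (D n) :=
    harmonicOnNhd_comp_of_differentiableOn hgharm isOpen_ball (hψ n).1 (hD n).1.1 (hψ n).2.1.mapsTo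
  obtain ⟨v, hv, hvε, hvfail⟩ := hfail n (fun z => g (ψ n z)) hstar_harm
    (fun z hz => hgnn _ ((hψ n).2.1.mapsTo hz))
  have hζ : ψ n (Site.toComplex v) ∈ closedBall (0 : ℂ) (1 - ε) := mem_closedBall_zero_iff.2 hvε.le
  have hclose := hk' _ hζ
  rw [(hψ n).leftInvOn hv, nearestSite_one_toComplex, Real.dist_eq] at hclose
  exact absurd hclose (not_lt.2 hvfail.le)

/-- **Lawler–Schramm–Werner 2004, Lemma 5.3 (Continuous harmonic approximation).** "For every
`ε > 0` there is some `r₀ = r₀(ε) > 0` such that the following holds. If `D ∈ 𝔇` satisfies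
`inrad(D) ≥ r₀` and `h : V_D ∪ ∂V_D → [0, ∞)` is discrete-harmonic in `V_D`, then there exists a
harmonic function `h* : D → [0, ∞)` such that `|h*(v) - h(v)| ≤ ε h(0)` holds for every vertex
`v ∈ V_D` satisfying `|ψ_D(v)| < 1 - ε`." Here `h ≥ 0` is a function on `ℤ²` lattice-harmonic at
the sites of `V(D)` (its values off `V(D) ∪ ∂V(D)` are irrelevant), `ψ` is any disc map of `D`
(`IsDiscMap`), and `h*` is harmonic and nonnegative on `D`. (Normalise by `h(0)` and use
`continuousHarmonicApproximation_normalised`; if `h(0) = 0` then `h = 0` at the vertices in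
question by the conformal Harnack inequality, and `h* = 0` will do.)
[cite: LawlerSchrammWerner2004, Lemma 5.3] -/
theorem continuousHarmonicApproximation (ε : ℝ) (hε : 0 < ε) :
    ∃ r₀ : ℝ, 0 < r₀ ∧ ∀ D : Set ℂ, IsClassD D → r₀ ≤ infDist (0 : ℂ) Dᶜ →
      ∀ ψ : ℂ → ℂ, IsDiscMap D ψ → ∀ h : Site 2 → ℝ, (∀ w, 0 ≤ h w) →
        IsLatticeHarmonicOn h (latticeVertices D) →
        ∃ hstar : ℂ → ℝ, InnerProductSpace.HarmonicOnNhd hstar D ∧ (∀ z ∈ D, 0 ≤ hstar z) ∧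
          ∀ v ∈ latticeVertices D, ‖ψ (Site.toComplex v)‖ < 1 - ε →
            |hstar (Site.toComplex v) - h v| ≤ ε * h 0 := by
  obtain ⟨r₁, hr₁, hmain⟩ := continuousHarmonicApproximation_normalised ε hε
  -- the Harnack radius for the degenerate case `h(0) = 0` (only relevant when `ε < 1`)
  rcases le_or_gt 1 ε with hε1 | hε1
  · -- `ε ≥ 1`: no vertex satisfies `|ψ v| < 1 - ε ≤ 0`, so `h* = 0` works vacuously
    refine ⟨r₁, hr₁, fun D hD hRD ψ hψ h hpos hharm => ⟨fun _ => 0, ?_, fun _ _ => le_rfl, ?_⟩⟩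
    · intro z hz
      exact InnerProductSpace.harmonicAt_const 0
    · intro v hv hvε
      exact absurd (lt_of_lt_of_le hvε (by linarith)) (not_lt.2 (norm_nonneg _))
  · set r : ℝ := 1 - ε with hr
    have hr0 : 0 < r := by rw [hr]; linarith
    have hrl : r < 1 := by rw [hr]; linarith
    set N : ℕ := ⌈(11000 : ℝ) / (1 - r) ^ 5⌉₊ with hN
    have hN' : (11000 : ℝ) / (1 - r) ^ 5 ≤ N := Nat.le_ceil _
    refine ⟨max r₁ (10000 / (1 - r) ^ 2), lt_max_of_lt_left hr₁, ?_⟩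
    intro D hD hRD ψ hψ h hpos hharm
    have hR₁ : r₁ ≤ infDist (0 : ℂ) Dᶜ := (le_max_left _ _).trans hRD
    have hbig : 10000 ≤ infDist (0 : ℂ) Dᶜ * (1 - r) ^ 2 := by
      have h1 : 10000 / (1 - r) ^ 2 ≤ infDist (0 : ℂ) Dᶜ := (le_max_right _ _).trans hRD
      rwa [div_le_iff₀ (by nlinarith)] at h1
    rcases (hpos 0).eq_or_lt with h00 | h00
    · -- `h(0) = 0`: `h = 0` at the vertices with `|ψ v| ≤ 1 - ε`, take `h* = 0`
      refine ⟨fun _ => 0, fun z hz => InnerProductSpace.harmonicAt_const 0, fun _ _ => le_rfl, ?_⟩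
      intro v hv hvε
      have hk := (harnack_isDiscMap hD hψ hpos hharm hrl hbig hN' hv hvε.le).2
      rw [← h00] at hk
      have hc : 0 < (maneuverConst / 2) ^ N := by have := maneuverConst_pos; positivity
      have hv0 : h v ≤ 0 := by
        by_contra hlt
        push Not at hlt
        have : 0 < (maneuverConst / 2) ^ N * h v := mul_pos hc hlt
        linarith
      have hv0' : h v = 0 := le_antisymm hv0 (hpos v)
      rw [hv0', ← h00]
      simp
    · -- `h(0) > 0`: normalise
      set c : ℝ := h 0 with hc
      have hc0 : 0 < c := h00
      have hharmc : IsLatticeHarmonicOn (fun w => c⁻¹ * h w) (latticeVertices D) := fun v hv => by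
        rw [latticeLaplacian_const_mul, hharm v hv, mul_zero]
      obtain ⟨hstar, hharm', hnn', happrox⟩ := hmain D hD hR₁ ψ hψ (fun w => c⁻¹ * h w)
        (fun w => mul_nonneg (inv_nonneg.2 hc0.le) (hpos w)) hharmc
        (by rw [hc]; exact inv_mul_cancel₀ hc0.ne')
      refine ⟨fun z => c * hstar z, ?_, fun z hz => mul_nonneg hc0.le (hnn' z hz), ?_⟩
      · intro z hz
        exact (hharm' z hz).const_smul (c := c)
      · intro v hv hvε
        have h1 := happrox v hv hvε
        have h2 : c * hstar (Site.toComplex v) - h v = c * (hstar (Site.toComplex v) - c⁻¹ * h v) := by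
          field_simp
        rw [h2, abs_mul, abs_of_pos hc0, mul_comm]
        exact mul_le_mul_of_nonneg_right h1 hc0.le |>.trans_eq (by ring)

end LSWGrid

end Literature.Probability.LatticeModels

end
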